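import Literature.MathematicalPhysics.QuantumFieldTheory.Balaban1983to89.B2Eq29Resummation
import Literature.MathematicalPhysics.QuantumFieldTheory.Balaban1983to89.B2Ineq213SmallFactors

/-!
# `Balaban1983to89.B2Eq215Assembly` — T. Bałaban, *(Higgs)₂,₃ quantum fields in a finite volume. II. An upper bound*, Commun. Math. Phys. **86** (1982) 555–594 [Balaban1982Higgs2]: the step from **(2.13)** to **(2.15)** p. 559 — applying the small-factor inequality (2.13) to EVERY term of the right side of (2.9) produces exactly the resummed small factor ζ_{Λ₀} of (2.15) — PROVED (theorems only)

statement-level skeleton of published theorems with citation tags; proofs where landed; nothing here is a claim about the Yang–Mills mass gap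

PDF held: `paper:balaban1982-cmp86-higgs23-ii` (doi 10.1007/bf01214890; journal page = PDF page + 554); pp. 558–559 [PDF 4–5]
READ AS IMAGES on the ×2 renders `run/shared/lean/pub/pub-balaban/b2b-balaban-ref1/pages/1982-cmp86-higgs23-II/1982-cmp86-higgs23-II-p004-x2.png`,
`…-p005-x2.png`.

CITATION HEADER — WHAT IS REPRODUCED.  The sentence of p. 559 linking SKELETON rows **B2.Eq2.13** ((2.11)–(2.14)) and
**B2.Eq2.15** ((2.15)) of `run/shared/lean/pub/lit-balaban/SKELETON.md`: *"From these estimates we get the following one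
[(2.13)] … Let us denote [(2.15)]"* — i.e. WHY ζ_{Λ₀} carries the factor `exp(−p(ε)²|R_s|)` in place of `χ^c_{R_s}`.
Companion file (unit `lit-balaban-p23`, Phase-2 proof seat p23, generation 3; HOME `run/shared/lean/pub/lit-balaban/`) to
the two files of record it imports and does not restate: unit r14's `B2Eq29Resummation` ((2.9)/(2.10) and the
DEFINITION `zeta215`/`zetaW` of (2.15): `nbhd`, `Admissible`, `minimals`, `inner` = Λ₋₁, `rhs29`, `prod_weight215`) and
unit p15's `B2Ineq213SmallFactors` ((2.13): `ineq213_chi`, `ineq213_chi_snd`).  B2 fold owner r02, second reader r14;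
referee ref-4.

THE PRINTED TEXT (p. 559 [PDF 5], verbatim).  *"From these estimates we get the following one
  χ^c_{R_s} exp[−Σ_{x∈Λ₇ᶜ}(λ(ε)|φ(x)|⁴ + ½δm²ε²|φ(x)|²)] ≤ exp(−½p(ε)⁴|R_s|) exp(O(ε^{κ₀})|Λ₇ᶜ|)
    ≤ exp(−p(ε)²|R_s|) exp(O(ε^{κ₀})|Λ₇ᶜ|). (2.13)
… Let us denote  ζ_{Λ₀} = Σ_{{P_v,…,R_s} admissible, minimal for Λ₀} χ^c_{P_v}χ^c_{Q_v}χ^c_{R_v}χ^c_{P_s}χ^c_{Q_s} exp(−p(ε)²|R_s|). (2.15)"*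
with the right side of (2.9) p. 558 *"Σ_{{P_v,…,R_s} admissible, minimal} χ^c_{P_v}χ^c_{P_s}χ^c_{Q_v}χ^c_{Q_s}χ^c_{R_v}χ^c_{R_s}χ_{Λ₋₁}"*
and (p. 557, (2.2)/(2.5)) `χ^c_{R_s} = Π_{x∈R_s}χ({|φ(x)| > (1/λ(ε)^{1/4})p(ε)})`, `R_s ⊂ Λ₀ᶜ ⊂ Λ₇ᶜ` ((2.7)–(2.8)).

DICTIONARY (that of `B2Eq29Resummation` + `B2Ineq213SmallFactors`).  `S` ↤ the disjoint union of the six index sets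
(elements of 6-tuples), `isRs x` ↤ "x is of sort R_s", `pt x : γ` ↤ the point of T₁ underlying an element of sort R_s
(injective on that sort: `hinj`), `N`/`W` ↤ the (2.7) neighbourhood data and the region `W = Λ₀ᶜ`, `c x`/`s x` ↤
`χ^c_x`/`χ_x` (`0 ≤`), with, ON SORT R_s, `c x = χ({θ < |φ(pt x)|})` (`hcRs`; `θ` ↤ `p(ε)/λ(ε)^{1/4}`, `t y` ↤ `|φ(y)|`);
`Λc : Finset γ` ↤ the points of `Λ₇ᶜ` (containing every `R_s`: `hRs`); `lam'`, `m`, `C·ε^{κ₀}`, `pε` ↤ `λ(ε)`, `½δm²ε²`,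
the printed `O(ε^{κ₀})` of (2.11), `p(ε)` — the hypotheses `hl … hp` are VERBATIM those of
`B2Ineq213SmallFactors.ineq213_chi_snd` ((2.11), the (2.12)-threshold relation, `p(ε)² ≥ 2`).

WHAT IS KERNEL-CHECKED (no `def`s).  `prod_ite_eq_ite_forall` (a product of `{0,1}`-indicators is the indicator of the
conjunction: `Π_{x∈R_s}χ({…}) = χ^c_{R_s}`); `prod_split_sortRs` (the product over a tuple splits into its non-R_s and R_s
parts); **`summand_mul_exp_le`** (ONE minimal admissible tuple: `Π_{x∈τ}χ^c_x · e^{−V(Λ₇ᶜ)} ≤ [(2.15)-summand of τ]·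
e^{Cε^{κ₀}|Λ₇ᶜ|}`, by (2.13) on the point set `pt(τ ∩ R_s) ⊆ Λ₇ᶜ`, whose cardinality is `#(τ ∩ R_s)` by injectivity);
**`rhs29_mul_exp_le`** (the printed step: `[right side of (2.9)]·exp[−Σ_{x∈Λ₇ᶜ}(λ(ε)|φ(x)|⁴ + ½δm²ε²|φ(x)|²)] ≤
ζ_{Λ₀}·χ_{Λ₋₁}·exp(Cε^{κ₀}|Λ₇ᶜ|)`); `rhs29_mul_exp_le_quartic` (the same with the first member of (2.13),
`exp(−½p(ε)⁴|R_s|)`, as a `zetaW`); `sum_rhs29_mul_exp_le` (summed over any finite family of regions `W = Λ₀ᶜ`, each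
with its own `Λ₇ᶜ` — the (2.10)-level form in which the expansion is used under the integral (2.1), p. 558 bottom:
*"in each term of this sum we remove the interaction terms from the set Λ₇ᶜ"*).
-/

open Finset
open scoped Classical BigOperators

noncomputable section

namespace Literature.MathematicalPhysics.QuantumFieldTheory.Balaban1983to89.B2Eq215Assembly

open B2Eq29Resummation

variable {S γ : Type*}

/-! ## §1 Two pieces of finite-product bookkeeping -/

/-- A product of `{0,1}`-valued characteristic functions is the characteristic function of the conjunction:
`Π_{x∈R}χ({E_x}) = χ({E_x for all x ∈ R})` — the meaning of the superscript-`c` products of (2.4)/(2.5) p. 557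
(`χ^c_{R_s} = Π_{x∈R_s}χ({|φ(x)| > (1/λ(ε)^{1/4})p(ε)})`). [cite: Balaban1982Higgs2, (2.5) p.557] -/
theorem prod_ite_eq_ite_forall (R : Finset S) (E : S → Prop) :
    ∏ x ∈ R, (if E x then (1 : ℝ) else 0) = if ∀ x ∈ R, E x then 1 else 0 := by
  induction R using Finset.induction_on with
  | empty => simp
  | insert a R ha ih =>
    rw [Finset.prod_insert ha, ih]
    by_cases hEa : E a
    · by_cases hR : ∀ x ∈ R, E x
      · rw [if_pos hEa, if_pos hR, one_mul, if_pos ((Finset.forall_mem_insert a R E).2 ⟨hEa, hR⟩)]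
      · rw [if_pos hEa, if_neg hR, one_mul, if_neg (fun h => hR ((Finset.forall_mem_insert a R E).1 h).2)]
    · rw [if_neg hEa, zero_mul, if_neg (fun h => hEa ((Finset.forall_mem_insert a R E).1 h).1)]

/-- The product of the large-field characteristic functions over a 6-tuple splits into its part over the five sorts
`P_v, Q_v, R_v, P_s, Q_s` and its part over the sort `R_s` (the split (2.15) acts on). [cite: Balaban1982Higgs2, (2.15) p.559] -/
theorem prod_split_sortRs (isRs : S → Prop) (c : S → ℝ) (τ : Finset S) :
    ∏ x ∈ τ, c x = (∏ x ∈ τ.filter (fun x => ¬isRs x), c x) * ∏ x ∈ τ.filter isRs, c x := by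
  rw [← Finset.prod_filter_mul_prod_filter_not τ isRs, mul_comm]

/-! ## §2 One minimal admissible tuple: (2.13) on its `R_s`-part -/

section OneTuple

variable [DecidableEq γ]

/-- **(2.13) applied to one term of the right side of (2.9).**  For a tuple `τ` whose sort-`R_s` elements have their points
in `Λ₇ᶜ`, with `χ^c_x = χ({θ < |φ(pt x)|})` on that sort and `pt` injective on it:
`Π_{x∈τ}χ^c_x · exp[−Σ_{y∈Λ₇ᶜ}(λ(ε)|φ(y)|⁴ + ½δm²ε²|φ(y)|²)] ≤ [Π_{x∈τ, x∉R_s}χ^c_x · exp(−p(ε)²·#(τ∩R_s))] · exp(Cε^{κ₀}|Λ₇ᶜ|)`,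
the bracket being the `τ`-summand of ζ_{Λ₀} (2.15) (`B2Eq29Resummation.prod_weight215`).  Hypotheses `hl … hp` verbatim
from `B2Ineq213SmallFactors.ineq213_chi_snd`. [cite: Balaban1982Higgs2, (2.13)–(2.15) p.559] -/
theorem summand_mul_exp_le (isRs : S → Prop) (pt : S → γ) (hinj : ∀ x y, isRs x → isRs y → pt x = pt y → x = y)
    (Λc : Finset γ) (τ : Finset S) (hRs : ∀ x ∈ τ, isRs x → pt x ∈ Λc) (t : γ → ℝ) (c : S → ℝ)
    (hc : ∀ x, 0 ≤ c x) {θ : ℝ} (hcRs : ∀ x, isRs x → c x = if θ < t (pt x) then 1 else 0)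
    {lam' m C ε κ₀ pε : ℝ} (hl : 0 < lam') (hCε : 0 ≤ C * ε ^ κ₀) (hm : m ^ 2 ≤ 4 * lam' * (C * ε ^ κ₀))
    (hθ : 0 ≤ θ) (hθ4 : pε ^ 4 ≤ lam' * θ ^ 4) (hθ2 : -(2 * m / lam') ≤ θ ^ 2) (hp : 2 ≤ pε ^ 2) :
    (∏ x ∈ τ, c x) * Real.exp (-(∑ y ∈ Λc, (lam' * (t y ^ 2) ^ 2 + m * t y ^ 2)))
      ≤ (∏ x ∈ τ, (if isRs x then Real.exp (-(pε ^ 2)) else c x)) * Real.exp (C * ε ^ κ₀ * Λc.card) := by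
  -- the R_s-part of τ and its set of points
  set τR : Finset S := τ.filter isRs with hτR
  set R : Finset γ := τR.image pt with hR
  have hRsub : R ⊆ Λc := by
    intro y hy
    obtain ⟨x, hx, rfl⟩ := Finset.mem_image.1 hy
    exact hRs x (Finset.mem_filter.1 hx).1 (Finset.mem_filter.1 hx).2
  have hcard : R.card = τR.card := by
    refine Finset.card_image_of_injOn ?_
    intro x hx y hy hxy
    exact hinj x y (Finset.mem_filter.1 (Finset.mem_coe.1 hx)).2 (Finset.mem_filter.1 (Finset.mem_coe.1 hy)).2 hxy
  -- χ^c on the R_s-part is the indicator of "θ < |φ| at every point of R"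
  have hprodR : ∏ x ∈ τR, c x = if ∀ y ∈ R, θ < t y then (1 : ℝ) else 0 := by
    have h1 : ∏ x ∈ τR, c x = ∏ x ∈ τR, (if θ < t (pt x) then (1 : ℝ) else 0) :=
      Finset.prod_congr rfl fun x hx => hcRs x (Finset.mem_filter.1 hx).2
    rw [h1, prod_ite_eq_ite_forall τR (fun x => θ < t (pt x))]
    have hiff : (∀ x ∈ τR, θ < t (pt x)) ↔ ∀ y ∈ R, θ < t y := by
      rw [hR, Finset.forall_mem_image]
    by_cases hall : ∀ x ∈ τR, θ < t (pt x)
    · rw [if_pos hall, if_pos (hiff.1 hall)]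
    · rw [if_neg hall, if_neg (fun h => hall (hiff.2 h))]
  -- (2.13) on R ⊆ Λ₇ᶜ
  have h213 := B2Ineq213SmallFactors.ineq213_chi_snd Λc R hRsub t hl hCε hm hθ hθ4 hθ2 hp
  rw [hcard] at h213
  -- assemble
  have hnonRs : 0 ≤ ∏ x ∈ τ.filter (fun x => ¬isRs x), c x := Finset.prod_nonneg fun x _ => hc x
  rw [prod_split_sortRs isRs c τ, prod_weight215 isRs c pε τ, hprodR]
  calc (∏ x ∈ τ.filter (fun x => ¬isRs x), c x) * (if ∀ y ∈ R, θ < t y then (1 : ℝ) else 0) *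
          Real.exp (-(∑ y ∈ Λc, (lam' * (t y ^ 2) ^ 2 + m * t y ^ 2)))
        = (∏ x ∈ τ.filter (fun x => ¬isRs x), c x) *
            ((if ∀ y ∈ R, θ < t y then (1 : ℝ) else 0) *
              Real.exp (-(∑ y ∈ Λc, (lam' * (t y ^ 2) ^ 2 + m * t y ^ 2)))) := by ring
    _ ≤ (∏ x ∈ τ.filter (fun x => ¬isRs x), c x) *
            (Real.exp (-(pε ^ 2 * (τR.card : ℝ))) * Real.exp (C * ε ^ κ₀ * Λc.card)) :=
          mul_le_mul_of_nonneg_left h213 hnonRs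
    _ = (∏ x ∈ τ.filter (fun x => ¬isRs x), c x) * Real.exp (-(pε ^ 2 * (τR.card : ℝ))) *
            Real.exp (C * ε ^ κ₀ * Λc.card) := by ring

/-- The same with the FIRST member of (2.13), `exp(−½p(ε)⁴|R_s|)` (no hypothesis `p(ε)² ≥ 2`).
[cite: Balaban1982Higgs2, (2.13) p.559] -/
theorem summand_mul_exp_le_quartic (isRs : S → Prop) (pt : S → γ)
    (hinj : ∀ x y, isRs x → isRs y → pt x = pt y → x = y)
    (Λc : Finset γ) (τ : Finset S) (hRs : ∀ x ∈ τ, isRs x → pt x ∈ Λc) (t : γ → ℝ) (c : S → ℝ)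
    (hc : ∀ x, 0 ≤ c x) {θ : ℝ} (hcRs : ∀ x, isRs x → c x = if θ < t (pt x) then 1 else 0)
    {lam' m C ε κ₀ pε : ℝ} (hl : 0 < lam') (hCε : 0 ≤ C * ε ^ κ₀) (hm : m ^ 2 ≤ 4 * lam' * (C * ε ^ κ₀))
    (hθ : 0 ≤ θ) (hθ4 : pε ^ 4 ≤ lam' * θ ^ 4) (hθ2 : -(2 * m / lam') ≤ θ ^ 2) :
    (∏ x ∈ τ, c x) * Real.exp (-(∑ y ∈ Λc, (lam' * (t y ^ 2) ^ 2 + m * t y ^ 2)))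
      ≤ ((∏ x ∈ τ.filter (fun x => ¬isRs x), c x) *
            Real.exp (-(pε ^ 4 / 2 * ((τ.filter isRs).card : ℝ)))) * Real.exp (C * ε ^ κ₀ * Λc.card) := by
  set τR : Finset S := τ.filter isRs with hτR
  set R : Finset γ := τR.image pt with hR
  have hRsub : R ⊆ Λc := by
    intro y hy
    obtain ⟨x, hx, rfl⟩ := Finset.mem_image.1 hy
    exact hRs x (Finset.mem_filter.1 hx).1 (Finset.mem_filter.1 hx).2
  have hcard : R.card = τR.card := by
    refine Finset.card_image_of_injOn ?_
    intro x hx y hy hxy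
    exact hinj x y (Finset.mem_filter.1 (Finset.mem_coe.1 hx)).2 (Finset.mem_filter.1 (Finset.mem_coe.1 hy)).2 hxy
  have hprodR : ∏ x ∈ τR, c x = if ∀ y ∈ R, θ < t y then (1 : ℝ) else 0 := by
    have h1 : ∏ x ∈ τR, c x = ∏ x ∈ τR, (if θ < t (pt x) then (1 : ℝ) else 0) :=
      Finset.prod_congr rfl fun x hx => hcRs x (Finset.mem_filter.1 hx).2
    rw [h1, prod_ite_eq_ite_forall τR (fun x => θ < t (pt x))]
    have hiff : (∀ x ∈ τR, θ < t (pt x)) ↔ ∀ y ∈ R, θ < t y := by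
      rw [hR, Finset.forall_mem_image]
    by_cases hall : ∀ x ∈ τR, θ < t (pt x)
    · rw [if_pos hall, if_pos (hiff.1 hall)]
    · rw [if_neg hall, if_neg (fun h => hall (hiff.2 h))]
  have h213 := B2Ineq213SmallFactors.ineq213_chi Λc R hRsub t hl hCε hm hθ hθ4 hθ2
  rw [hcard] at h213
  have hnonRs : 0 ≤ ∏ x ∈ τ.filter (fun x => ¬isRs x), c x := Finset.prod_nonneg fun x _ => hc x
  rw [prod_split_sortRs isRs c τ, hprodR]
  calc (∏ x ∈ τ.filter (fun x => ¬isRs x), c x) * (if ∀ y ∈ R, θ < t y then (1 : ℝ) else 0) *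
          Real.exp (-(∑ y ∈ Λc, (lam' * (t y ^ 2) ^ 2 + m * t y ^ 2)))
        = (∏ x ∈ τ.filter (fun x => ¬isRs x), c x) *
            ((if ∀ y ∈ R, θ < t y then (1 : ℝ) else 0) *
              Real.exp (-(∑ y ∈ Λc, (lam' * (t y ^ 2) ^ 2 + m * t y ^ 2)))) := by ring
    _ ≤ (∏ x ∈ τ.filter (fun x => ¬isRs x), c x) *
            (Real.exp (-(pε ^ 4 / 2 * (τR.card : ℝ))) * Real.exp (C * ε ^ κ₀ * Λc.card)) :=
          mul_le_mul_of_nonneg_left h213 hnonRs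
    _ = (∏ x ∈ τ.filter (fun x => ¬isRs x), c x) * Real.exp (-(pε ^ 4 / 2 * (τR.card : ℝ))) *
            Real.exp (C * ε ^ κ₀ * Λc.card) := by ring

end OneTuple

/-! ## §3 The printed step (2.13) ⇒ (2.15) on the right side of (2.9) -/

section Assembly

variable {β : Type*} [Fintype S] [DecidableEq γ]

/-- **(2.13) ⇒ (2.15), as printed** (p. 559 *"From these estimates we get … Let us denote ζ_{Λ₀} = …"*): for the region
`W = Λ₀ᶜ` with its class of minimal admissible 6-tuples (unit r14's `minimals N W`), if every sort-`R_s` element of every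
such tuple has its point in `Λ₇ᶜ` (`R_s ⊂ Λ₀ᶜ ⊂ Λ₇ᶜ`), then, under the hypotheses of (2.13),
  `[Σ_{adm, min} χ^c_{P_v}χ^c_{P_s}χ^c_{Q_v}χ^c_{Q_s}χ^c_{R_v}χ^c_{R_s}χ_{Λ₋₁}] · exp[−Σ_{y∈Λ₇ᶜ}(λ(ε)|φ(y)|⁴ + ½δm²ε²|φ(y)|²)]
      ≤ ζ_{Λ₀} · χ_{Λ₋₁} · exp(Cε^{κ₀}|Λ₇ᶜ|)`,
i.e. `rhs29 N W c s · e^{−V(Λ₇ᶜ)} ≤ zeta215 N W isRs c p(ε) · Π_{x∈Λ₋₁}χ_x · e^{Cε^{κ₀}|Λ₇ᶜ|}` — the bound that enters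
(2.41)–(2.43). [cite: Balaban1982Higgs2, (2.15) p.559] -/
theorem rhs29_mul_exp_le (N : S → Finset β) (W : Finset β) (isRs : S → Prop) (pt : S → γ)
    (hinj : ∀ x y, isRs x → isRs y → pt x = pt y → x = y) (Λc : Finset γ)
    (hRs : ∀ τ ∈ minimals N W, ∀ x ∈ τ, isRs x → pt x ∈ Λc) (t : γ → ℝ) (c s : S → ℝ)
    (hc : ∀ x, 0 ≤ c x) (hs : ∀ x, 0 ≤ s x) {θ : ℝ} (hcRs : ∀ x, isRs x → c x = if θ < t (pt x) then 1 else 0)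
    {lam' m C ε κ₀ pε : ℝ} (hl : 0 < lam') (hCε : 0 ≤ C * ε ^ κ₀) (hm : m ^ 2 ≤ 4 * lam' * (C * ε ^ κ₀))
    (hθ : 0 ≤ θ) (hθ4 : pε ^ 4 ≤ lam' * θ ^ 4) (hθ2 : -(2 * m / lam') ≤ θ ^ 2) (hp : 2 ≤ pε ^ 2) :
    rhs29 N W c s * Real.exp (-(∑ y ∈ Λc, (lam' * (t y ^ 2) ^ 2 + m * t y ^ 2)))
      ≤ zeta215 N W isRs c pε * (∏ x ∈ inner N W, s x) * Real.exp (C * ε ^ κ₀ * Λc.card) := by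
  have hsnn : 0 ≤ ∏ x ∈ inner N W, s x := Finset.prod_nonneg fun x _ => hs x
  rw [rhs29, zeta215_eq, zetaW_def, Finset.sum_mul, Finset.sum_mul, Finset.sum_mul]
  refine Finset.sum_le_sum fun τ hτ => ?_
  have hone := summand_mul_exp_le isRs pt hinj Λc τ (hRs τ hτ) t c hc hcRs hl hCε hm hθ hθ4 hθ2 hp
  calc (∏ x ∈ τ, c x) * (∏ x ∈ inner N W, s x) *
          Real.exp (-(∑ y ∈ Λc, (lam' * (t y ^ 2) ^ 2 + m * t y ^ 2)))
        = ((∏ x ∈ τ, c x) * Real.exp (-(∑ y ∈ Λc, (lam' * (t y ^ 2) ^ 2 + m * t y ^ 2)))) *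
            ∏ x ∈ inner N W, s x := by ring
    _ ≤ ((∏ x ∈ τ, (if isRs x then Real.exp (-(pε ^ 2)) else c x)) * Real.exp (C * ε ^ κ₀ * Λc.card)) *
            ∏ x ∈ inner N W, s x := mul_le_mul_of_nonneg_right hone hsnn
    _ = (∏ x ∈ τ, (if isRs x then Real.exp (-(pε ^ 2)) else c x)) * (∏ x ∈ inner N W, s x) *
            Real.exp (C * ε ^ κ₀ * Λc.card) := by ring

/-- The same with the first member of (2.13): `… ≤ [Σ_{adm, min} χ^c_{P_v}χ^c_{Q_v}χ^c_{R_v}χ^c_{P_s}χ^c_{Q_s}·exp(−½p(ε)⁴|R_s|)]·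
χ_{Λ₋₁}·exp(Cε^{κ₀}|Λ₇ᶜ|)`, the bracket written as unit r14's `zetaW` with the factor `exp(−½p(ε)⁴)` on sort `R_s` (no
hypothesis `p(ε)² ≥ 2`). [cite: Balaban1982Higgs2, (2.13) p.559] -/
theorem rhs29_mul_exp_le_quartic (N : S → Finset β) (W : Finset β) (isRs : S → Prop) (pt : S → γ)
    (hinj : ∀ x y, isRs x → isRs y → pt x = pt y → x = y) (Λc : Finset γ)
    (hRs : ∀ τ ∈ minimals N W, ∀ x ∈ τ, isRs x → pt x ∈ Λc) (t : γ → ℝ) (c s : S → ℝ)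
    (hc : ∀ x, 0 ≤ c x) (hs : ∀ x, 0 ≤ s x) {θ : ℝ} (hcRs : ∀ x, isRs x → c x = if θ < t (pt x) then 1 else 0)
    {lam' m C ε κ₀ pε : ℝ} (hl : 0 < lam') (hCε : 0 ≤ C * ε ^ κ₀) (hm : m ^ 2 ≤ 4 * lam' * (C * ε ^ κ₀))
    (hθ : 0 ≤ θ) (hθ4 : pε ^ 4 ≤ lam' * θ ^ 4) (hθ2 : -(2 * m / lam') ≤ θ ^ 2) :
    rhs29 N W c s * Real.exp (-(∑ y ∈ Λc, (lam' * (t y ^ 2) ^ 2 + m * t y ^ 2)))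
      ≤ zetaW N W (fun x => if isRs x then Real.exp (-(pε ^ 4 / 2)) else c x) * (∏ x ∈ inner N W, s x) *
          Real.exp (C * ε ^ κ₀ * Λc.card) := by
  have hsnn : 0 ≤ ∏ x ∈ inner N W, s x := Finset.prod_nonneg fun x _ => hs x
  rw [rhs29, zetaW_def, Finset.sum_mul, Finset.sum_mul, Finset.sum_mul]
  refine Finset.sum_le_sum fun τ hτ => ?_
  have hone := summand_mul_exp_le_quartic isRs pt hinj Λc τ (hRs τ hτ) t c hc hcRs hl hCε hm hθ hθ4 hθ2
  -- the zetaW-summand with exp(−½p⁴) on sort R_s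
  have hw : ∏ x ∈ τ, (if isRs x then Real.exp (-(pε ^ 4 / 2)) else c x)
      = (∏ x ∈ τ.filter (fun x => ¬isRs x), c x) * Real.exp (-(pε ^ 4 / 2 * ((τ.filter isRs).card : ℝ))) := by
    rw [← Finset.prod_filter_mul_prod_filter_not τ isRs, mul_comm]
    congr 1
    · exact Finset.prod_congr rfl fun x hx => by simp [(Finset.mem_filter.1 hx).2]
    · rw [Finset.prod_congr rfl fun x hx => if_pos (Finset.mem_filter.1 hx).2, Finset.prod_const, ← Real.exp_nat_mul]
      congr 1
      ring
  rw [hw]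
  calc (∏ x ∈ τ, c x) * (∏ x ∈ inner N W, s x) *
          Real.exp (-(∑ y ∈ Λc, (lam' * (t y ^ 2) ^ 2 + m * t y ^ 2)))
        = ((∏ x ∈ τ, c x) * Real.exp (-(∑ y ∈ Λc, (lam' * (t y ^ 2) ^ 2 + m * t y ^ 2)))) *
            ∏ x ∈ inner N W, s x := by ring
    _ ≤ ((∏ x ∈ τ.filter (fun x => ¬isRs x), c x) * Real.exp (-(pε ^ 4 / 2 * ((τ.filter isRs).card : ℝ))) *
            Real.exp (C * ε ^ κ₀ * Λc.card)) * ∏ x ∈ inner N W, s x := mul_le_mul_of_nonneg_right hone hsnn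
    _ = (∏ x ∈ τ.filter (fun x => ¬isRs x), c x) * Real.exp (-(pε ^ 4 / 2 * ((τ.filter isRs).card : ℝ))) *
            (∏ x ∈ inner N W, s x) * Real.exp (C * ε ^ κ₀ * Λc.card) := by ring

/-- **Summed over the regions** ((2.10)-level; p. 558 bottom: *"The above expansion is introduced under the integral (2.1)
and we get a sum of terms. … in each term of this sum we remove the interaction terms from the set Λ₇ᶜ"*): for any finite
family of regions `W = Λ₀ᶜ` (index `o`), each with its own `Λ₇ᶜ = Λc o ⊇` the `R_s`-points of its minimal tuples,
`Σ_{Λ₀} [right side of (2.9)]·e^{−V(Λ₇ᶜ)} ≤ Σ_{Λ₀} ζ_{Λ₀}·χ_{Λ₋₁}·e^{Cε^{κ₀}|Λ₇ᶜ|}`. [cite: Balaban1982Higgs2, (2.10), (2.15) pp.558–559] -/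
theorem sum_rhs29_mul_exp_le {O : Type*} (regions : Finset O) (N : S → Finset β) (W : O → Finset β)
    (isRs : S → Prop) (pt : S → γ) (hinj : ∀ x y, isRs x → isRs y → pt x = pt y → x = y) (Λc : O → Finset γ)
    (hRs : ∀ o ∈ regions, ∀ τ ∈ minimals N (W o), ∀ x ∈ τ, isRs x → pt x ∈ Λc o) (t : γ → ℝ) (c s : S → ℝ)
    (hc : ∀ x, 0 ≤ c x) (hs : ∀ x, 0 ≤ s x) {θ : ℝ} (hcRs : ∀ x, isRs x → c x = if θ < t (pt x) then 1 else 0)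
    {lam' m C ε κ₀ pε : ℝ} (hl : 0 < lam') (hCε : 0 ≤ C * ε ^ κ₀) (hm : m ^ 2 ≤ 4 * lam' * (C * ε ^ κ₀))
    (hθ : 0 ≤ θ) (hθ4 : pε ^ 4 ≤ lam' * θ ^ 4) (hθ2 : -(2 * m / lam') ≤ θ ^ 2) (hp : 2 ≤ pε ^ 2) :
    ∑ o ∈ regions, rhs29 N (W o) c s * Real.exp (-(∑ y ∈ Λc o, (lam' * (t y ^ 2) ^ 2 + m * t y ^ 2)))
      ≤ ∑ o ∈ regions, zeta215 N (W o) isRs c pε * (∏ x ∈ inner N (W o), s x) *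
          Real.exp (C * ε ^ κ₀ * (Λc o).card) :=
  Finset.sum_le_sum fun o ho =>
    rhs29_mul_exp_le N (W o) isRs pt hinj (Λc o) (hRs o ho) t c s hc hs hcRs hl hCε hm hθ hθ4 hθ2 hp

end Assembly

end Literature.MathematicalPhysics.QuantumFieldTheory.Balaban1983to89.B2Eq215Assembly

end
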